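import Summits.CriticalPhenomena.PercolationContinuityZ3.Theorems.PercNearOneGluingNoHeavyQuantSubfloorPairHub
import Summits.CriticalPhenomena.PercolationContinuityZ3.Theorems.PercNearOneGluingNoHeavyQuantTorqueCost
import HarnessLib

/-!
# QUANT lane R8, T-DEC: ONE FAR-GIANT PIECE BESIDE A BIG HEAVY BLOB — `C(γ) ∗ blob₃(g)` is SDEC at the true floor although `C(γ)` alone is not
# (the mixed core of the piece expansion of the node's residue: glued children `R[qᵢ](R²[gᵢ])`)

builds on p205010 (kernel theorem, internal audit signed; external expert review pending)

Support file (`--supports stmt-CriticalPhenomena-4575`), QUANT lane seat prim-quant-census-1 (gen 30); memo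
`run/shared/lean/prim/quant/prim-quant-census-1/g30/SUBFLOOR-HUBS-G30.md` §0 (4)/(6).  Theorems only (standard axioms, no sorries) over arm-1
g50's layer-free TORQUE-COST criterion `decAt_all_of_torqueCost` (`…QuantTorqueCost`) and the sub-floor hub files `…QuantSubfloorPairHub` ✓ /
`…QuantSubfloorTripleHub` (this seat).

THE SETTING.  The gated glued child `R[q](R²[g])` (`m = q(1+2g) ≥ 2`) is the forced same-mean mixture of the heavy blob `blob₃(m/3)` (gate
`m/3 ≥ x`) and the FAR-GIANT PIECE `C(γ) = {1,3;γ}`, `γ = (m−1)/2`.  Expanding a forest of glued children over these choices, the terms with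
EXACTLY ONE far-giant piece are `C(γᵢ) ∗ ∏_{j≠i} blob₃(mⱼ/3)`; all but one heavy blob peel off (`sdec_lconv_blobLaw`), so their core is
`C(γ) ∗ blob₃(g')` with `g' = mⱼ/3 ∈ [2/3, 1)`, `x ≤ g'` — a far-giant piece RESCUED by one big heavy blob of another sibling.  Exact census (memo
§0 (4), 1 884 instances): `{lo,lo+K;γ} ∗ blob_B(g)` is SDEC at `x` iff `Kγ ≤ lo + B(2−g)` iff its FAR rows hold; for `lo=1, K=2, B=3` always.
* **`sdec_farPieceBlob`**: for `0 < x`, `1/2 ≤ γ < 1`, `2/3 ≤ g < 1`, `x ≤ g`, `3x ≤ 1+2γ`: `SDEC x 6 (C(γ) ∗ blob₃(g))`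
  (`= {1: (1−γ)(1−g), 3: γ(1−g), 4: (1−γ)g, 6: γg}`).  CERTIFICATE per outer gate `a` (`T = a(1+2γ+3g) < 6`): no positive low for `T ≤ 2`;
  for `2 < T ≤ 2+3g` the low atom `1` goes ENTIRELY to `4` (capacity ⟸ `θ ≤ g`; torque cost `(4−T)⁺·load ≤ u₁(T−1)` ⟸ `3θ ≤ T−1`); for
  `T > 2+3g` ENTIRELY to `6` (capacity ⟸ `θ ≤ g`, `γ ≥ 1/2`; cost `(6−T)·load ≤ u₁(T−1)+u₃(T−3)+u₄(T−4)` ⟸ `θ(3T−6) ≤ 4(T−3)` ⟸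
  `(T−4)(T−6) ≤ 0`).  The one-route rules 'all to 4' / 'all to 6' alone fail (exact census); the switch at `T = 2+3g` is where the credit gate
  of `1 → 4` reaches `g`.
* `farPieceBlob_eq_lconv` (`C(γ) ∗ gate δ₃ g` pointwise), route algebra `cost_le_of_theta`, `farPieceBlob_cap4/cap6/cost4/cost6/theta6`,
  and the glued-children reading **`sdec_farPieceBlob_glued`** (`γ = (m₁−1)/2`, `g = m₂/3`, floor `x ≤ min(q₁g₁, q₂g₂)`).
With `sdec_pairHub` / `sdec_tripleHub` this completes the three CORES of the width-3 glued-children instance (memo §3: the 8-term assembly is next).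

HONEST STATUS.  `SiblingStep` ⟺ `GateStepN`, `FarTreeRow` OPEN; RATE class (log\*) / honest sentence of `run/shared/lean/prim/quant/README.md`
unchanged.  [this work].  Nothing here is cited as a published result.  The gluing rows served [cite: KozmaNitzan2024, Conjecture 3 (p. 15)];
product measure [cite: Grimmett1999, §1.3 p. 10].
-/

noncomputable section

open scoped BigOperators

namespace Summit.CriticalPhenomena.PercolationContinuityZ3.Theorems
namespace Quant
namespace LawDec

open Finset

/-- the FAR-GIANT PIECE `C(γ) = {1, 3; γ}` -/
local notation3 "CP[" a "]" => (fun h : ℕ => (1 - (a : ℝ)) * (if h = 1 then (1 : ℝ) else 0) + (a : ℝ) * (if h = 3 then (1 : ℝ) else 0))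

/-- the far-giant piece beside a heavy 3-blob: `C(γ) ∗ blob₃(g)` on `{1, 3, 4, 6}` -/
local notation3 "FB[" a ", " b "]" => (fun h : ℕ =>
  (1 - (a : ℝ)) * (1 - (b : ℝ)) * (if h = 1 then (1 : ℝ) else 0) + (a : ℝ) * (1 - (b : ℝ)) * (if h = 3 then (1 : ℝ) else 0) +
  (1 - (a : ℝ)) * (b : ℝ) * (if h = 4 then (1 : ℝ) else 0) + (a : ℝ) * (b : ℝ) * (if h = 6 then (1 : ℝ) else 0))

/-- `C(γ) ∗ blob₃(g)` is the convolution of the far-giant piece with the gated 3-blob `gate δ₃ g`. [this work] -/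
theorem farPieceBlob_eq_lconv (γ g : ℝ) :
    lconv 3 3 CP[γ] (gate (fun h : ℕ => if h = 3 then (1 : ℝ) else 0) g) = FB[γ, g] := by
  funext h
  simp only [lconv, Finset.sum_range_succ, Finset.sum_range_zero, gate_apply]
  rcases Nat.lt_or_ge h 7 with hh | hh
  · interval_cases h
    all_goals norm_num
  · simp [show h ≠ 1 by omega, show h ≠ 3 by omega, show h ≠ 4 by omega, show h ≠ 6 by omega, show (1 : ℕ) ≠ h by omega,
      show (3 : ℕ) ≠ h by omega, show (4 : ℕ) ≠ h by omega, show (6 : ℕ) ≠ h by omega]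

/-! ### Route algebra (layer-free rates `θ/(1−θ)`) -/

/-- torque cost of one route: `θ < 1`, `c·θ·A ≤ (1−θ)·R` ⟹ `c·(θ/(1−θ)·A) ≤ R`. [this work] -/
theorem cost_le_of_theta {θ c A R : ℝ} (hθ1 : θ < 1) (h : c * θ * A ≤ (1 - θ) * R) : c * (θ / (1 - θ) * A) ≤ R := by
  have h1 : 0 < 1 - θ := sub_pos.2 hθ1
  have e : c * (θ / (1 - θ) * A) = c * θ * A / (1 - θ) := by
    field_simp
  rw [e, div_le_iff₀ h1]
  linarith

/-- capacity of the route `1 → 4`: `θ ≤ g` ⟹ `θ·(u₁ + u₄) ≤ u₄` (`u₁ = a(1−γ)(1−g)`, `u₄ = a(1−γ)g`). [this work] -/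
theorem farPieceBlob_cap4 {θ a γ g : ℝ} (hθg : θ ≤ g) (ha : 0 ≤ a) (nγ : 0 ≤ 1 - γ) :
    θ * (a * ((1 - γ) * (1 - g)) + a * ((1 - γ) * g)) ≤ a * ((1 - γ) * g) := by
  have e : a * ((1 - γ) * (1 - g)) + a * ((1 - γ) * g) = a * (1 - γ) := by ring
  rw [e]
  have := mul_le_mul_of_nonneg_right hθg (mul_nonneg ha nγ)
  linarith

/-- capacity of the route `1 → 6`: `θ ≤ g`, `γ ≥ 1/2` ⟹ `θ·(u₁ + u₆) ≤ u₆` (`u₆ = aγg`; `u₆ − g(u₁+u₆) = a·g(1−g)(2γ−1)`). [this work] -/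
theorem farPieceBlob_cap6 {θ a γ g : ℝ} (hθg : θ ≤ g) (ha : 0 ≤ a) (nγ : 0 ≤ 1 - γ) (hγ : 1 / 2 ≤ γ) (pg : 0 ≤ g) (ng : 0 ≤ 1 - g) :
    θ * (a * ((1 - γ) * (1 - g)) + a * (γ * g)) ≤ a * (γ * g) := by
  have e0 : 0 ≤ a * ((1 - γ) * (1 - g)) + a * (γ * g) := by
    have : 0 ≤ γ := by linarith
    positivity
  have h1 := mul_le_mul_of_nonneg_right hθg e0
  nlinarith [mul_nonneg (mul_nonneg (mul_nonneg ha pg) ng) (show (0 : ℝ) ≤ 2 * γ - 1 by linarith)]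

/-- torque cost of the far route `1 → 4` (`T < 4`): `3θ ≤ T − 1` ⟹ `(4−T)·θ·A ≤ (1−θ)·(A(T−1))`. [this work] -/
theorem farPieceBlob_cost4 {θ T A : ℝ} (h3 : 3 * θ ≤ T - 1) (hA : 0 ≤ A) : (4 - T) * θ * A ≤ (1 - θ) * (A * (T - 1)) := by
  nlinarith [mul_nonneg hA (show (0 : ℝ) ≤ T - 1 - 3 * θ by linarith)]

/-- torque cost of the far route `1 → 6` (`4 ≤ T ≤ 6`): `θ(3T−6) ≤ 4(T−3)`, `u₁ ≤ u₃`, `2u₁ ≤ u₄` ⟹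
`(6−T)·θ·u₁ ≤ (1−θ)·(u₁(T−1) + u₃(T−3) + u₄(T−4))`. [this work] -/
theorem farPieceBlob_cost6 {θ T u₁ u₃ u₄ : ℝ} (h4 : 4 ≤ T) (h6 : T ≤ 6) (hθ : θ * (3 * T - 6) ≤ 4 * (T - 3))
    (hu1 : 0 ≤ u₁) (h31 : u₁ ≤ u₃) (h41 : 2 * u₁ ≤ u₄) :
    (6 - T) * θ * u₁ ≤ (1 - θ) * (u₁ * (T - 1) + u₃ * (T - 3) + u₄ * (T - 4)) := by
  have hθ1 : θ ≤ 1 := by nlinarith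
  nlinarith [mul_nonneg hu1 (show (0 : ℝ) ≤ 4 * (T - 3) - θ * (3 * T - 6) by linarith),
    mul_nonneg (show (0 : ℝ) ≤ 1 - θ by linarith) (mul_nonneg (show (0 : ℝ) ≤ u₃ - u₁ by linarith) (show (0 : ℝ) ≤ T - 3 by linarith)),
    mul_nonneg (show (0 : ℝ) ≤ 1 - θ by linarith) (mul_nonneg (show (0 : ℝ) ≤ u₄ - 2 * u₁ by linarith) (show (0 : ℝ) ≤ T - 4 by linarith))]

/-- the gate condition `θ(3T−6) ≤ 4(T−3)` on `[4,6]`: for `θ = (T−2)/5` and for every `θ ≤ T/6`. [this work] -/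
theorem farPieceBlob_theta6 {θ T : ℝ} (h4 : 4 ≤ T) (h6 : T ≤ 6) (hθ : θ = (T - 2) / 5 ∨ 6 * θ ≤ T) :
    θ * (3 * T - 6) ≤ 4 * (T - 3) := by
  have hq : 0 ≤ (T - 4) * (6 - T) := mul_nonneg (by linarith) (by linarith)
  rcases hθ with rfl | hθ
  · nlinarith
  · nlinarith [mul_le_mul_of_nonneg_right hθ (show (0 : ℝ) ≤ 3 * T - 6 by linarith)]

/-! ### The far-giant piece beside a big heavy blob -/

/-- **ONE FAR-GIANT PIECE BESIDE A BIG HEAVY BLOB IS SDEC.**  For `0 < x`, `1/2 ≤ γ < 1`, `2/3 ≤ g < 1`, `x ≤ g`, `3x ≤ 1 + 2γ`: the law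
`C(γ) ∗ blob₃(g) = {1: (1−γ)(1−g), 3: γ(1−g), 4: (1−γ)g, 6: γg}` is `SDEC x 6` — although `C(γ)` alone is not SDEC at `x > γ`.  Certificate per
outer gate `a` (`T = a(1+2γ+3g)`): no positive low for `T ≤ 2`; the low atom `1` is shipped ENTIRELY to `4` while `T ≤ 2 + 3g` (capacity ⟸ `θ ≤ g`;
torque cost `(4−T)⁺·load ≤ u₁(T−1)` ⟸ `3θ ≤ T−1`) and ENTIRELY to `6` when `T > 2 + 3g` (capacity ⟸ `θ ≤ g`, `γ ≥ 1/2`; cost by `farPieceBlob_cost6`),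
via arm-1 g50's `decAt_all_of_torqueCost`. [this work] -/
theorem sdec_farPieceBlob {x γ g : ℝ} (hx0 : 0 < x) (hγ : 1 / 2 ≤ γ) (hγ1 : γ < 1) (hg : 2 / 3 ≤ g) (hg1 : g < 1) (hxg : x ≤ g)
    (hxγ : 3 * x ≤ 1 + 2 * γ) : SDEC x 6 FB[γ, g] := by
  have hx1 : x < 1 := by linarith
  have nγ : (0 : ℝ) ≤ 1 - γ := by linarith
  have ng : (0 : ℝ) ≤ 1 - g := by linarith
  have pγ : (0 : ℝ) ≤ γ := by linarith
  have pg : (0 : ℝ) ≤ g := by linarith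
  have u1n : 0 ≤ (1 - γ) * (1 - g) := mul_nonneg nγ ng
  have u3n : 0 ≤ γ * (1 - g) := mul_nonneg pγ ng
  have u4n : 0 ≤ (1 - γ) * g := mul_nonneg nγ pg
  have u6n : 0 ≤ γ * g := mul_nonneg pγ pg
  -- law facts
  have l0 : ∀ h, 0 ≤ FB[γ, g] h := by
    intro h; dsimp only; split_ifs <;> linarith
  have lM : ∀ h, 6 < h → FB[γ, g] h = 0 := by
    intro h hh; dsimp only; rw [if_neg (by omega), if_neg (by omega), if_neg (by omega), if_neg (by omega)]; ring
  have l1 : ∑ h ∈ Finset.range (6 + 1), FB[γ, g] h = 1 := by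
    simp [Finset.sum_range_succ]; ring
  have lmean : ∑ h ∈ Finset.range (6 + 1), (h : ℝ) * FB[γ, g] h = 1 + 2 * γ + 3 * g := by
    simp [Finset.sum_range_succ]; ring
  have h6x : 6 * x ≤ 1 + 2 * γ + 3 * g := by linarith
  -- structural inequalities among the atoms
  have h31 : (1 - γ) * (1 - g) ≤ γ * (1 - g) := mul_le_mul_of_nonneg_right (by linarith) ng
  have h41 : 2 * ((1 - γ) * (1 - g)) ≤ (1 - γ) * g := by
    have : 2 * (1 - g) ≤ g := by linarith
    nlinarith [mul_le_mul_of_nonneg_left this nγ]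
  intro a ha0 ha1 j' hj'
  obtain ⟨g0, gM, g1⟩ := gate_laws 6 FB[γ, g] a ha0.le ha1 l0 lM l1
  have gmean : ∑ h ∈ Finset.range (6 + 1), (h : ℝ) * gate FB[γ, g] a h = a * (1 + 2 * γ + 3 * g) := by
    rw [sum_mul_gate, lmean]
  set T : ℝ := a * (1 + 2 * γ + 3 * g) with hT
  have hax0 : 0 < a * x := mul_pos ha0 hx0
  have haxx : a * x ≤ x := by
    have := mul_le_mul_of_nonneg_right ha1 hx0.le
    linarith
  have hax1 : a * x < 1 := by linarith
  have haxg : a * x ≤ g := haxx.trans hxg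
  have hT0 : 0 < T := by rw [hT]; positivity
  have hTle : T ≤ 1 + 2 * γ + 3 * g := by
    have := mul_le_mul_of_nonneg_right ha1 (show (0 : ℝ) ≤ 1 + 2 * γ + 3 * g by linarith)
    linarith
  have hT6 : T < 6 := by linarith
  have h6axT : 6 * (a * x) ≤ T := by
    have := mul_le_mul_of_nonneg_left h6x ha0.le
    linarith
  have hta : a * x * ((6 : ℕ) : ℝ) ≤ T := by push_cast; linarith
  have v1 : gate FB[γ, g] a 1 = a * ((1 - γ) * (1 - g)) := by rw [gate_apply]; norm_num
  have v2 : gate FB[γ, g] a 2 = 0 := by rw [gate_apply]; norm_num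
  have v3 : gate FB[γ, g] a 3 = a * (γ * (1 - g)) := by rw [gate_apply]; norm_num
  have v4 : gate FB[γ, g] a 4 = a * ((1 - γ) * g) := by rw [gate_apply]; norm_num
  have v6 : gate FB[γ, g] a 6 = a * (γ * g) := by rw [gate_apply]; norm_num
  by_cases hT2 : 2 < T
  · -- the budget terms: every charged atom `l < T` contributes `A(l)·(T − l) ≥ 0`
    set F : ℕ → ℝ := fun l => if (1 ≤ l ∧ (l : ℝ) < T) then gate FB[γ, g] a l * (T - l) else 0 with hF
    have Fnn : ∀ l ∈ Finset.range (6 + 1), 0 ≤ F l := by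
      intro l _; rw [hF]; dsimp only; split_ifs with hc
      · exact mul_nonneg (g0 l) (by linarith [hc.2])
      · exact le_rfl
    have F1 : F 1 = gate FB[γ, g] a 1 * (T - 1) := by
      rw [hF]; dsimp only; rw [if_pos ⟨le_rfl, by push_cast; linarith⟩]; push_cast; ring
    have bud1 : gate FB[γ, g] a 1 * (T - 1) ≤ ∑ l ∈ Finset.range (6 + 1), F l := by
      rw [← F1]; exact Finset.single_le_sum Fnn (by simp)
    -- the route and its two facts (capacity, cost)
    obtain ⟨t, ht, hTt, hcapt, hcostt⟩ : ∃ t : ℕ, (t = 4 ∨ t = 6) ∧ (T < 1 + (t : ℝ)) ∧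
        freeRate (a * x) T 1 t * gate FB[γ, g] a 1 ≤ gate FB[γ, g] a t ∧
        (if T < (t : ℝ) then ((t : ℝ) - T) * (freeRate (a * x) T 1 t * gate FB[γ, g] a 1) else 0) ≤ ∑ l ∈ Finset.range (6 + 1), F l := by
      by_cases hreg : T ≤ 2 + 3 * g
      · -- regime I: everything to `4`
        have eθ : freeRate (a * x) T 1 4 = max (a * x) ((T - 2) / 3) / (1 - max (a * x) ((T - 2) / 3)) := by
          unfold freeRate; norm_num
        have hθ1 : max (a * x) ((T - 2) / 3) < 1 := max_lt hax1 (by linarith)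
        have hθg : max (a * x) ((T - 2) / 3) ≤ g := max_le haxg (by linarith)
        have hθ3 : 3 * max (a * x) ((T - 2) / 3) ≤ T - 1 := by
          rcases le_total (a * x) ((T - 2) / 3) with hle | hle
          · rw [max_eq_right hle]; linarith
          · rw [max_eq_left hle]; linarith
        refine ⟨4, Or.inl rfl, by push_cast; linarith, ?_, ?_⟩
        · rw [eθ, v1, v4]
          exact rate_mul_le_of_theta hθ1 (farPieceBlob_cap4 hθg ha0.le nγ) (mul_nonneg ha0.le u1n)
        · refine le_trans ?_ bud1
          split_ifs with hT4
          · have c4 := farPieceBlob_cost4 hθ3 (mul_nonneg ha0.le u1n)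
            have c4' := cost_le_of_theta hθ1 c4
            push_cast
            rw [eθ, v1]
            exact c4'
          · exact mul_nonneg (g0 1) (by linarith)
      · -- regime II: everything to `6`
        have hreg' : 2 + 3 * g < T := lt_of_not_ge hreg
        have hT4 : 4 ≤ T := by linarith
        have eθ : freeRate (a * x) T 1 6 = max (a * x) ((T - 2) / 5) / (1 - max (a * x) ((T - 2) / 5)) := by
          unfold freeRate; norm_num
        have hθ1 : max (a * x) ((T - 2) / 5) < 1 := max_lt hax1 (by linarith)
        have hθg : max (a * x) ((T - 2) / 5) ≤ g := max_le haxg (by linarith)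
        have hθc : max (a * x) ((T - 2) / 5) * (3 * T - 6) ≤ 4 * (T - 3) := by
          rcases le_total (a * x) ((T - 2) / 5) with hle | hle
          · rw [max_eq_right hle]; exact farPieceBlob_theta6 hT4 hT6.le (Or.inl rfl)
          · rw [max_eq_left hle]; exact farPieceBlob_theta6 hT4 hT6.le (Or.inr h6axT)
        -- the budget: the three charged terms `1, 3, 4` below `T`
        have F3 : F 3 = gate FB[γ, g] a 3 * (T - 3) := by
          rw [hF]; dsimp only; rw [if_pos ⟨by norm_num, by push_cast; linarith⟩]; push_cast; ring
        have F4 : F 4 = gate FB[γ, g] a 4 * (T - 4) := by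
          rw [hF]; dsimp only; rw [if_pos ⟨by norm_num, by push_cast; linarith⟩]; push_cast; ring
        have bud3 : gate FB[γ, g] a 1 * (T - 1) + gate FB[γ, g] a 3 * (T - 3) + gate FB[γ, g] a 4 * (T - 4) ≤
            ∑ l ∈ Finset.range (6 + 1), F l := by
          have hsub : ({1, 3, 4} : Finset ℕ) ⊆ Finset.range (6 + 1) := by
            intro l hl; simp only [Finset.mem_insert, Finset.mem_singleton] at hl; simp only [Finset.mem_range]; omega
          have h := Finset.sum_le_sum_of_subset_of_nonneg hsub (fun l hl _ => Fnn l hl)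
          have e : ∑ l ∈ ({1, 3, 4} : Finset ℕ), F l = F 1 + F 3 + F 4 := by
            rw [Finset.sum_insert (by simp), Finset.sum_insert (by simp), Finset.sum_singleton]; ring
          rw [e, F1, F3, F4] at h; exact h
        refine ⟨6, Or.inr rfl, by push_cast; linarith, ?_, ?_⟩
        · rw [eθ, v1, v6]
          exact rate_mul_le_of_theta hθ1 (farPieceBlob_cap6 hθg ha0.le nγ hγ pg ng) (mul_nonneg ha0.le u1n)
        · refine le_trans ?_ bud3
          have h41a : 2 * (a * ((1 - γ) * (1 - g))) ≤ a * ((1 - γ) * g) := by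
            have := mul_le_mul_of_nonneg_left h41 ha0.le
            linarith
          have h31a : a * ((1 - γ) * (1 - g)) ≤ a * (γ * (1 - g)) := mul_le_mul_of_nonneg_left h31 ha0.le
          have c6 := farPieceBlob_cost6 hT4 hT6.le hθc (mul_nonneg ha0.le u1n) h31a h41a
          have c6' := cost_le_of_theta hθ1 c6
          rw [if_pos (by push_cast; linarith), eθ, v1, v3, v4]
          push_cast
          exact c6'
    have ht6 : t ≤ 6 := by rcases ht with rfl | rfl <;> norm_num
    have htmem : t ∈ Finset.range (6 + 1) := Finset.mem_range.2 (by omega)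
    have row1 : ∑ h ∈ Finset.range (6 + 1), (if 1 = 1 ∧ h = t then gate FB[γ, g] a 1 else 0) = gate FB[γ, g] a 1 := by
      rw [Finset.sum_eq_single_of_mem t htmem (fun h _ hh => by simp [hh])]
      simp
    have rowz : ∀ l : ℕ, l ≠ 1 → ∑ h ∈ Finset.range (6 + 1), (if l = 1 ∧ h = t then gate FB[γ, g] a 1 else 0) = 0 := by
      intro l hl; exact Finset.sum_eq_zero fun h _ => by simp [hl]
    have colt : ∑ l ∈ Finset.range (6 + 1), freeRate (a * x) T l t * (if l = 1 ∧ t = t then gate FB[γ, g] a 1 else 0)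
        = freeRate (a * x) T 1 t * gate FB[γ, g] a 1 := by
      rw [Finset.sum_eq_single_of_mem 1 (by simp) (fun l _ hl => by simp [hl])]
      simp
    have colz : ∀ h : ℕ, h ≠ t →
        ∑ l ∈ Finset.range (6 + 1), freeRate (a * x) T l h * (if l = 1 ∧ h = t then gate FB[γ, g] a 1 else 0) = 0 := by
      intro h hh; exact Finset.sum_eq_zero fun l _ => by simp [hh]
    refine decAt_all_of_torqueCost (a * x) 6 (gate FB[γ, g] a) T (fun l h => if l = 1 ∧ h = t then gate FB[γ, g] a 1 else 0)
      hax0 hax1 g0 gM g1 gmean hT0 hta ?_ ?_ ?_ ?_ ?_ j' hj'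
    · -- nonnegativity
      intro l h; split_ifs
      · exact g0 1
      · exact le_rfl
    · -- support
      intro l h hlh
      split_ifs at hlh with hc
      · obtain ⟨rfl, rfl⟩ := hc
        exact ⟨le_rfl, by push_cast; linarith, by omega, ht6, by push_cast; linarith⟩
      · exact absurd hlh (lt_irrefl _)
    · -- rows
      intro l hl hlow
      have hl3 : l < 3 := by
        have : (l : ℝ) < 3 := by linarith
        exact_mod_cast this
      interval_cases l
      · exact row1
      · rw [rowz 2 (by norm_num), v2]
    · -- capacities
      intro h _
      by_cases hh : h = t
      · subst hh; rw [colt]; exact hcapt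
      · rw [colz h hh]; exact g0 h
    · -- torque cost
      rw [Finset.sum_eq_single_of_mem t htmem (fun h _ hh => by rw [colz h hh, mul_zero, ite_self])]
      rw [colt]
      exact hcostt
  · -- no positive low atom
    refine decAt_all_of_lowCeiling (a * x) 6 (gate FB[γ, g] a) T hax0 hax1 g0 gM g1 gmean hT0 hta ?_ j' hj'
    intro l hl hlow _
    exfalso
    have : (1 : ℝ) ≤ l := by exact_mod_cast hl
    linarith

/-- **GLUED-CHILDREN READING**: for two glued children `R[qᵢ](R²[gᵢ])` with `mᵢ = qᵢ(1+2gᵢ) ≥ 2` and a floor `0 < x ≤ min(q₁g₁, q₂g₂)`, the mixed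
core `C((m₁−1)/2) ∗ blob₃(m₂/3)` of the piece expansion is `SDEC x 6`. [this work] -/
theorem sdec_farPieceBlob_glued {x q₁ g₁ q₂ g₂ : ℝ} (hx0 : 0 < x) (hq₁ : 0 < q₁) (hq₁' : q₁ < 1) (hg₁ : 0 < g₁) (hg₁' : g₁ < 1)
    (hq₂ : 0 < q₂) (hq₂' : q₂ < 1) (hg₂ : 0 < g₂) (hg₂' : g₂ < 1) (hm₁ : 2 ≤ q₁ * (1 + 2 * g₁)) (hm₂ : 2 ≤ q₂ * (1 + 2 * g₂))
    (hx₁ : x ≤ q₁ * g₁) (hx₂ : x ≤ q₂ * g₂) :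
    SDEC x 6 (lconv 3 3 CP[(q₁ * (1 + 2 * g₁) - 1) / 2] (gate (fun h : ℕ => if h = 3 then (1 : ℝ) else 0) (q₂ * (1 + 2 * g₂) / 3))) := by
  obtain ⟨a1, a2, a3, _⟩ := gluedChild_piece_facts hq₁ hq₁' hg₁ hg₁' hm₁ hx₁
  have b1 : 2 / 3 ≤ q₂ * (1 + 2 * g₂) / 3 := by linarith
  have b2 : q₂ * (1 + 2 * g₂) / 3 < 1 := by
    have : q₂ * (1 + 2 * g₂) < 1 + 2 * g₂ := by nlinarith
    linarith
  have b3 : x ≤ q₂ * (1 + 2 * g₂) / 3 := by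
    have : q₂ * g₂ ≤ q₂ := by nlinarith
    linarith
  rw [farPieceBlob_eq_lconv]
  exact sdec_farPieceBlob hx0 a1 a2 b1 b2 b3 a3

end LawDec
end Quant
end Summit.CriticalPhenomena.PercolationContinuityZ3.Theorems
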